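import Summits.BirchSwinnertonDyer.BirchSwinnertonDyer.Theorems.ByReductionTypeAtTwoMultTransportTwistedDescentLocalPackageInertia
import Summits.BirchSwinnertonDyer.BirchSwinnertonDyer.Theorems.ByReductionTypeAtTwoMultTransportTwistedDescentLocalGenerator
import Summits.BirchSwinnertonDyer.BirchSwinnertonDyer.Theorems.ByReductionTypeAtTwoMultTransportTwistedDescentTwistedExtend
import Summits.BirchSwinnertonDyer.BirchSwinnertonDyer.Theorems.ByReductionTypeAtTwoMultTransportTwistedDescentTwistedLift
import Summits.BirchSwinnertonDyer.BirchSwinnertonDyer.Theorems.ByReductionTypeAtTwoMultTransportTwistedDescentHTwoBound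
import Literature.NumberTheory.EllipticCurves.ZpExtensionGaloisTwistLocal
import Literature.NumberTheory.EllipticCurves.ZpExtensionGaloisTwistPrimary
import Literature.NumberTheory.EllipticCurves.H1CorestrictionIndexTwo
import Literature.NumberTheory.EllipticCurves.WeilPairingTateDual
import Literature.NumberTheory.EllipticCurves.SelmerCorankAssembly
import HarnessLib

/-!
# T-42 in the kernel, LXII: the local statement `T2` at a single place `v ∋ 2` and class `c`, for ANY
# Greenberg LINE PACKAGE at `v` (reduction-type-generic form of file XL `…TwistedDescentT2Core`)

Cell `bsd-2adic` (run/shared/lean/pub/bsd-2adic/), seat `bsd-2adic-t42` (BRIEF-T42), GEN 29 (memo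
`t42/DESIGN-T42-ADDENDUM-33.md`, «F3a road»). HONEST FRAMING: research route; THEOREMS ONLY (no `def`, no named
fact, no instance); nothing booked; nothing re-keyed; BSD is not proved by any of this. PARTITION: X5@2 GV-transport
rows whose REFERENCE curve is GOOD ORDINARY at `2` (K4ᵐ B1·O1; the binder `hF3a` of p744459) × p = 2 —
types-the-object-of; bears_on K4 items 19922 / 19923 (`--supports stmt-BirchSwinnertonDyer-19923`).

File XL (`exists_twisted_class_of_kummer`, GEN 17) proves Greenberg's local twisted descent at `v ∋ 2` for `E/ℚ`
MULTIPLICATIVE at `2`, drawing from the Tate parametrisation exactly one thing: the LINE PACKAGE of file XXXVII.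
`exists_twisted_class_of_kummer_of_linePackage` re-proves the SAME statement with the package as HYPOTHESIS and
no reduction-type binder — inputs: a datum `N` at `v` with (d) `N.plus` `2`-divisible, (c) `#(N.plus ∩ E[2^∞][2]) = 2`,
(i) `N.plus`-valued continuous crossed homomorphisms of `(ker κ)_v` into `E[2^∞]` are Kummer coboundaries in
`E(ℚ̄_v)`, (s) Kummer ⇒ strict over `ℚ_∞`: `W.localKerOver 2 (ker κ) ℚ_v ≤ N.strictKer (ker κ)`, (iv) every
`σ ∈ I_{ℚ_v}` acting on `μ_{2^n}(ℚ̄_v)` as `ζ ↦ ζ^a` acts on `N.plus ∩ E[2^∞][2^n]` as `c ↦ a•c`. The proof is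
file XL's VERBATIM except §3, where the correcting torsion point `m₀` («`u σ₀ f(σ₀⁻¹τσ₀) − f(τ) − ∂m₀(τ) ∈ C`
on `G_K`») is read off the STRICT condition (s) of the class `u·conj_{σ₀} c − c` through the cocycle criterion for
`strictKer` instead of package (iii). Consumer: `…TwistedDescentOrdLinePackage` / `…OrdT2Final` (same GEN).

References: [GreenbergLNM1716] §2 Props. 2.2, 2.4, §4 pp. 105–108, 123–125; [GreenbergVatsal2000] §2 pp. 14–17, 26;
[SerreGaloisCohomology1997] I §2.2–2.5, II §5.2; [NeukirchSchmidtWingberg2008] (1.3.2), (1.6.3); [Greenberg1989] §1 p. 98.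
-/

set_option autoImplicit false
set_option linter.dupNamespace false

noncomputable section

open scoped Classical AddSubgroup

namespace Summit.BirchSwinnertonDyer.BirchSwinnertonDyer.Theorems.MultTransportTwistedDescent

open NumberField IsDedekindDomain Field WeierstrassCurve CategoryTheory Function
  Literature.NumberTheory.GaloisRepresentations Literature.NumberTheory.EllipticCurves
  Literature.NumberTheory.EllipticCurves.GreenbergSelmer IsDedekindDomain.HeightOneSpectrum
  ContinuousCohomology TopRep ContRepresentation Literature.Barriers.BirchSwinnertonDyer

set_option maxHeartbeats 800000 in
/-- **`T2` at one place `v ∋ 2` and one class `c`, from a LINE PACKAGE at `v`** (reduction-type-generic form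
of file XL `exists_twisted_class_of_kummer`; see the module docstring for the inputs (d), (c), (i), (s), (iv) and the
proof). [cite: GreenbergLNM1716, §4 pp. 107, 124] [cite: GreenbergVatsal2000, §2 pp. 14–17]
[cite: SerreGaloisCohomology1997, I §2.2–2.5, II §5.2] [cite: Greenberg1989, §1 p. 98] -/
theorem exists_twisted_class_of_kummer_of_linePackage (W : WeierstrassCurve ℚ) [W.IsElliptic] [W.IsGloballyMinimal]
    (κ : ZpExtension ℚ 2) (hκ : κ.IsCyclotomic)
    (γ : absoluteGaloisGroup ℚ) (hγ : κ.IsTopGenerator γ) {v : HeightOneSpectrum (𝓞 ℚ)}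
    (hv2 : ((2 : ℕ) : 𝓞 ℚ) ∈ v.asIdeal)
    (N : LocalDatum ℚ (W.geomPrimaryTorsion 2) v)
    (hdiv : ∀ c ∈ N.plus, ∃ c' ∈ N.plus, 2 • c' = c)
    (hcard : Nat.card ↥(N.plus ⊓ (↥(W.geomPrimaryTorsion 2))[(2 : ℤ)]) = 2)
    (hKumC : ∀ (f : localSubgroup κ.kerSubgroup (v.adicCompletion ℚ) → W.geomPrimaryTorsion 2),
      (∀ τ, f τ ∈ N.plus) → Continuous f →
      (∀ τ₁ τ₂, f (τ₁ * τ₂) = f τ₁ + resGal (K := ℚ) (v.adicCompletion ℚ)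
        (τ₁ : absoluteGaloisGroup (v.adicCompletion ℚ)) • f τ₂) →
      ∃ Q : localPoints W (v.adicCompletion ℚ),
        ∀ τ : localSubgroup κ.kerSubgroup (v.adicCompletion ℚ),
          pointsMap W (v.adicCompletion ℚ) (f τ : W.geomPoints) =
            (τ : absoluteGaloisGroup (v.adicCompletion ℚ)) • Q - Q)
    (hKS : W.localKerOver 2 κ.kerSubgroup (v.adicCompletion ℚ) ≤ N.strictKer κ.kerSubgroup)
    (hInert : ∀ σ ∈ absInertia (v.adicCompletion ℚ), ∀ (n a : ℕ),
      (∀ ζ : (AlgebraicClosure (v.adicCompletion ℚ))ˣ, ζ ^ 2 ^ n = 1 →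
        Units.map (Field.absoluteGaloisGroup.toAlgEquiv (v.adicCompletion ℚ) σ :
          AlgebraicClosure (v.adicCompletion ℚ) →* AlgebraicClosure (v.adicCompletion ℚ)) ζ = ζ ^ a) →
      ∀ c ∈ N.plus, 2 ^ n • c = 0 →
        resGal (K := ℚ) (v.adicCompletion ℚ) σ • c = a • c)
    (u : ℤ) (hu : (2 : ℤ) ∣ u - 1) (hu1 : u ≠ 1)
    (c : W.subgroupH1 2 κ.kerSubgroup)
    (hc : u • W.conjH1 2 κ.kerSubgroup γ c - c ∈ W.localKerOver 2 κ.kerSubgroup (v.adicCompletion ℚ)) :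
    ∃ (J : ℕ) (t : galoisCohomology
      ((W.twistedTorsionGaloisModule 2 κ J u hu).restrictField (v.adicCompletion ℚ)) 1),
      W.twistedTorsionToLocalH1 2 κ J u hu (v.adicCompletion ℚ) t =
        W.localResOver 2 κ.kerSubgroup (v.adicCompletion ℚ) c := by
  -- (no `CharZero ℚ_v` instance is introduced in this proof: it would change the `ℚ`-algebra structure of `ℚ_v`)
  haveI := absoluteGaloisGroup_compactSpace (v.adicCompletion ℚ)
  haveI := absoluteGaloisGroup_compactSpace ℚ
  haveI : CompactSpace κ.kerSubgroup := isCompact_iff_compactSpace.1 κ.isClosed_kerSubgroup.isCompact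
  have hγ' : κ γ = Multiplicative.ofAdd 1 := hγ
  /- §1 the local inertial generator (file XXXIV) -/
  obtain ⟨σ₀, hσ₀I, hσ₀⟩ := exists_mem_absInertia_kappa_resGal_eq 2 κ hκ hv2 γ
  rw [hγ'] at hσ₀
  /- §2 `conj_γ = conj_{σ₀|ℚ̄}` on `H¹(ℚ_∞, E[2^∞])` (inner automorphisms act trivially) -/
  have hconj : W.conjH1 2 κ.kerSubgroup γ =
      W.conjH1 2 κ.kerSubgroup (resGal (K := ℚ) (v.adicCompletion ℚ) σ₀) := by
    have hmem : (resGal (K := ℚ) (v.adicCompletion ℚ) σ₀)⁻¹ * γ ∈ κ.kerSubgroup := by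
      rw [ZpExtension.mem_kerSubgroup, map_mul, map_inv, hσ₀, hγ', inv_mul_cancel]
    conv_lhs => rw [← mul_inv_cancel_left (resGal (K := ℚ) (v.adicCompletion ℚ) σ₀) γ]
    rw [W.conjH1_mul_holds 2 κ.kerSubgroup (resGal (K := ℚ) (v.adicCompletion ℚ) σ₀)
      ((resGal (K := ℚ) (v.adicCompletion ℚ) σ₀)⁻¹ * γ), W.conjH1_of_mem_holds 2 κ.kerSubgroup hmem,
      AddMonoidHom.comp_id]
  /- §3 a cocycle `f` of `c`; the STRICT condition (hypothesis (s)) of `u·conj_{σ₀} c − c` on cocycles; `m₀` -/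
  obtain ⟨f, rfl⟩ := oneCocycleClass_surjective (discreteTopRep κ.kerSubgroup (W.geomPrimaryTorsion 2)) c
  set σ₀' := resGal (K := ℚ) (v.adicCompletion ℚ) σ₀ with hσ₀'
  let τ' : localSubgroup κ.kerSubgroup (v.adicCompletion ℚ) → κ.kerSubgroup :=
    fun τ ↦ resGalSubgroupOfEmb κ.kerSubgroup (closureEmb (K := ℚ) (v.adicCompletion ℚ)) τ
  have hτ' : ∀ τ, ((τ' τ : κ.kerSubgroup) : absoluteGaloisGroup ℚ) =
      resGal (K := ℚ) (v.adicCompletion ℚ) (τ : absoluteGaloisGroup (v.adicCompletion ℚ)) := fun _ ↦ rfl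
  let k : localSubgroup κ.kerSubgroup (v.adicCompletion ℚ) → W.geomPrimaryTorsion 2 := fun τ ↦
    u • (σ₀' • f.1 (subgroupConj κ.kerSubgroup σ₀' (τ' τ))) - f.1 (τ' τ)
  have hm₀ex : ∃ m₀ : W.geomPrimaryTorsion 2, ∀ τ,
      k τ - (resGal (K := ℚ) (v.adicCompletion ℚ) (τ : absoluteGaloisGroup (v.adicCompletion ℚ)) • m₀ - m₀) ∈
        N.plus := by
    rw [hconj] at hc
    have hcS := hKS hc
    change u • conjH1 κ.kerSubgroup (W.geomPrimaryTorsion 2) σ₀' (oneCocycleClass _ f) -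
      oneCocycleClass _ f ∈ N.strictKer κ.kerSubgroup at hcS
    rw [conjH1_oneCocycleClass] at hcS
    -- the class `u • conj_{σ₀'} [f] - [f]` is the class of the cocycle `u • (σ₀' · f) - f`
    have hcl : u • oneCocycleClass (discreteTopRep κ.kerSubgroup (W.geomPrimaryTorsion 2))
          (conjCocycle κ.kerSubgroup σ₀' f) -
        oneCocycleClass (discreteTopRep κ.kerSubgroup (W.geomPrimaryTorsion 2)) f =
        oneCocycleClass (discreteTopRep κ.kerSubgroup (W.geomPrimaryTorsion 2))
          (u • conjCocycle κ.kerSubgroup σ₀' f - f) := by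
      have h : oneCocycleClassₗ (discreteTopRep κ.kerSubgroup (W.geomPrimaryTorsion 2))
          (u • conjCocycle κ.kerSubgroup σ₀' f - f) =
          u • oneCocycleClassₗ _ (conjCocycle κ.kerSubgroup σ₀' f) - oneCocycleClassₗ _ f := by
        rw [map_sub, map_zsmul]
      exact h.symm
    -- cocycle criterion for the strict condition (as `GoodModelLine.oneCocycleClass_mem_strictKer_iff`)
    have crit : ∀ g : contOneCocycles (discreteTopRep κ.kerSubgroup (W.geomPrimaryTorsion 2)),
        oneCocycleClass (discreteTopRep κ.kerSubgroup (W.geomPrimaryTorsion 2)) g ∈ N.strictKer κ.kerSubgroup ↔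
          ∃ q : N.Gr, ∀ x : decompIn κ.kerSubgroup v,
            N.grMk (g.1 (decompInToH κ.kerSubgroup v x)) = x • q - q := fun g ↦ by
      rw [LocalDatum.mem_strictKer_iff, LocalDatum.strictMap, resH1Hom_oneCocycleClass,
        oneCocycleClass_eq_zero_iff]
      rfl
    rw [hcl, crit] at hcS
    obtain ⟨q, hq⟩ := hcS
    obtain ⟨m₀, rfl⟩ := N.grMk_surjective q
    refine ⟨m₀, fun τ ↦ ?_⟩
    -- `τ ∈ G_K = (ker κ)_v` gives an element of `(ker κ) ⊓ D_v`
    have hτH : absGaloisRestrict ℚ (v.adicCompletion ℚ) (τ : absoluteGaloisGroup (v.adicCompletion ℚ)) ∈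
        κ.kerSubgroup := (mem_localSubgroup_iff κ.kerSubgroup (v.adicCompletion ℚ) τ.1).1 τ.2
    let x : decompIn κ.kerSubgroup v :=
      ⟨⟨absGaloisRestrict ℚ (v.adicCompletion ℚ) (τ : absoluteGaloisGroup (v.adicCompletion ℚ)),
        (mem_decomp_iff v _).2 ⟨τ, rfl⟩⟩, (mem_decompIn_iff κ.kerSubgroup v _).2 hτH⟩
    have hx : decompInToH κ.kerSubgroup v x = τ' τ := Subtype.ext rfl
    have h := hq x
    rw [hx, Subgroup.smul_def, LocalDatum.smul_grMk] at h
    have hval : (u • conjCocycle κ.kerSubgroup σ₀' f - f).1 (τ' τ) = k τ := rfl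
    have hxm : (((x : decompIn κ.kerSubgroup v) : decomp (K := ℚ) v) : absoluteGaloisGroup ℚ) • m₀ =
        resGal (K := ℚ) (v.adicCompletion ℚ) (τ : absoluteGaloisGroup (v.adicCompletion ℚ)) • m₀ := rfl
    rw [hval, hxm] at h
    rw [← N.ker_grMk, AddMonoidHom.mem_ker, map_sub, h, map_sub, sub_self]
  obtain ⟨m₀, hm₀⟩ := hm₀ex
  /- §4 the level `J`: the values of `f` and `m₀` lie in `E[2^J]` -/
  have htors : IsPrimaryTorsion 2 (W.geomPrimaryTorsion 2) := fun y ↦ by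
    obtain ⟨n, hn⟩ := y.2
    exact ⟨n, Subtype.ext hn⟩
  have hfin : (Set.range f.1 ∪ {m₀}).Finite :=
    (finite_range_of_compact_discrete f.1).union (Set.finite_singleton m₀)
  obtain ⟨J, hJ⟩ := ZpExtension.exists_pow_nsmul_eq_zero_of_finite htors hfin
  have hJf : ∀ h, 2 ^ J • f.1 h = 0 := fun h ↦ hJ _ (Or.inl ⟨h, rfl⟩)
  have hJm : 2 ^ J • m₀ = 0 := hJ _ (Or.inr rfl)
  have hlev : ∀ (n : ℕ) (P : W.geomPrimaryTorsion 2), 2 ^ n • P = 0 →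
      (P : W.geomPoints) ∈ W.geomTorsion ((2 ^ n : ℕ) : ℤ) := by
    intro n P hP
    rw [mem_geomTorsion_iff, natCast_zsmul, ← AddSubmonoidClass.coe_nsmul, hP, ZeroMemClass.coe_zero]
  let g : localSubgroup κ.kerSubgroup (v.adicCompletion ℚ) → W.geomTorsion ((2 ^ J : ℕ) : ℤ) :=
    fun τ ↦ ⟨f.1 (τ' τ), hlev J _ (hJf _)⟩
  let m₀J : W.geomTorsion ((2 ^ J : ℕ) : ℤ) := ⟨m₀, hlev J _ hJm⟩
  /- §5 the lines `C_n = C ∩ E[2^n]` -/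
  let Cn : ∀ n : ℕ, Submodule ℤ (W.geomTorsion ((2 ^ n : ℕ) : ℤ)) := fun n ↦
    (N.plus.comap (AddSubgroup.inclusion (geomTorsion_pow_le_geomPrimaryTorsion W 2 n))).toIntSubmodule
  have hCn : ∀ (n : ℕ) (T : W.geomTorsion ((2 ^ n : ℕ) : ℤ)), T ∈ Cn n ↔
      AddSubgroup.inclusion (geomTorsion_pow_le_geomPrimaryTorsion W 2 n) T ∈ N.plus := fun _ _ ↦ Iff.rfl
  have hCstab : ∀ (n : ℕ) (σ : absoluteGaloisGroup (v.adicCompletion ℚ)), Cn n ≤ (Cn n).comap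
      (((W.twistedTorsionGaloisModule 2 κ n u hu).restrict (absGaloisRestrict ℚ (v.adicCompletion ℚ))) σ) :=
    fun n ↦ line_le_comap_twistedTorsionGaloisModule W 2 κ n u hu N (Cn n) (hCn n)
  have htn : ∀ (n : ℕ) (T : W.geomTorsion ((2 ^ n : ℕ) : ℤ)), 2 ^ n • T = 0 := fun n T ↦ Subtype.ext (by
    rw [AddSubmonoidClass.coe_nsmul, ZeroMemClass.coe_zero, ← natCast_zsmul]
    exact (mem_geomTorsion_iff W _ _).1 T.2)
  /- §6 the extension of `f mod C_J` to `Γ_{ℚ_v}` (file XXXV), with `γ̃ = σ₀` -/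
  have hτ'mul : ∀ a b, τ' (a * b) = τ' a * τ' b := fun a b ↦
    map_mul (resGalSubgroupOfEmb κ.kerSubgroup (closureEmb (K := ℚ) (v.adicCompletion ℚ))) a b
  have hgcont : Continuous g := by
    have h1 : Continuous fun τ : localSubgroup κ.kerSubgroup (v.adicCompletion ℚ) ↦ f.1 (τ' τ) :=
      f.1.continuous.comp
        (resGalSubgroupOfEmb κ.kerSubgroup (closureEmb (K := ℚ) (v.adicCompletion ℚ))).continuous_toFun
    have h2 : Continuous fun τ : localSubgroup κ.kerSubgroup (v.adicCompletion ℚ) ↦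
        ((f.1 (τ' τ) : W.geomPrimaryTorsion 2) : W.geomPoints) := continuous_subtype_val.comp h1
    exact continuous_induced_rng.2 h2
  have hconjτ : ∀ τ, τ' (subgroupConj (localSubgroup κ.kerSubgroup (v.adicCompletion ℚ)) σ₀ τ) =
      subgroupConj κ.kerSubgroup σ₀' (τ' τ) := fun τ ↦ Subtype.ext (by
    rw [hτ', subgroupConj_apply_coe, subgroupConj_apply_coe, map_mul, map_mul, map_inv, hτ'])
  have hgcoc : ∀ τ₁ τ₂, g (τ₁ * τ₂) = g τ₁ +
      absGaloisRestrict ℚ (v.adicCompletion ℚ) (τ₁ : absoluteGaloisGroup (v.adicCompletion ℚ)) • g τ₂ := by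
    intro τ₁ τ₂
    apply Subtype.ext
    change ((f.1 (τ' (τ₁ * τ₂)) : W.geomPrimaryTorsion 2) : W.geomPoints) =
      (f.1 (τ' τ₁) : W.geomPoints) + ((absGaloisRestrict ℚ (v.adicCompletion ℚ)
        (τ₁ : absoluteGaloisGroup (v.adicCompletion ℚ)) • g τ₂ : W.geomTorsion ((2 ^ J : ℕ) : ℤ)) : W.geomPoints)
    rw [hτ'mul, cocycle_mul' f, AddSubgroup.coe_add, primaryComponent.coe_smul,
      Literature.NumberTheory.EllipticCurves.AddSubgroup.torsionBy.coe_smul, ← WeierstrassCurve.resGal_eq_absGaloisRestrict]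
    rfl
  have hm₀' : ∀ τ, (u • (absGaloisRestrict ℚ (v.adicCompletion ℚ) σ₀ •
      g (subgroupConj (localSubgroup κ.kerSubgroup (v.adicCompletion ℚ)) σ₀ τ)) - g τ) -
      (absGaloisRestrict ℚ (v.adicCompletion ℚ) (τ : absoluteGaloisGroup (v.adicCompletion ℚ)) • m₀J - m₀J) ∈
        Cn J := by
    intro τ
    rw [hCn]
    have heq : AddSubgroup.inclusion (geomTorsion_pow_le_geomPrimaryTorsion W 2 J)
        ((u • (absGaloisRestrict ℚ (v.adicCompletion ℚ) σ₀ •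
          g (subgroupConj (localSubgroup κ.kerSubgroup (v.adicCompletion ℚ)) σ₀ τ)) - g τ) -
        (absGaloisRestrict ℚ (v.adicCompletion ℚ) (τ : absoluteGaloisGroup (v.adicCompletion ℚ)) • m₀J - m₀J)) =
        k τ - (resGal (K := ℚ) (v.adicCompletion ℚ) (τ : absoluteGaloisGroup (v.adicCompletion ℚ)) • m₀ - m₀) := by
      apply Subtype.ext
      simp only [AddSubgroup.coe_inclusion, AddSubgroupClass.coe_sub,
        Literature.NumberTheory.EllipticCurves.AddSubgroup.torsionBy.coe_smul, primaryComponent.coe_smul,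
        ← WeierstrassCurve.resGal_eq_absGaloisRestrict, k]
      have hgc : ((g (subgroupConj (localSubgroup κ.kerSubgroup (v.adicCompletion ℚ)) σ₀ τ) :
          W.geomTorsion ((2 ^ J : ℕ) : ℤ)) : W.geomPoints) =
          ((f.1 (subgroupConj κ.kerSubgroup σ₀' (τ' τ)) : W.geomPrimaryTorsion 2) : W.geomPoints) := by
        rw [← hconjτ]
      rw [hgc]
    rw [heq]
    exact hm₀ τ
  obtain ⟨ξ, d, hξ⟩ := exists_cocycle_quotient_extend W κ J u hu (Cn J) hκ hv2 σ₀ hσ₀ g hgcont hgcoc m₀J hm₀'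
    (hCstab J)
  /- §7 the level `J + m`, `m = |u − 1|`, and the lift (files XXXVIII, XXXIX) -/
  set m := (u - 1).natAbs with hm
  have hJJ : J ≤ J + m := Nat.le_add_right J m
  haveI : Finite (W.geomTorsion ((2 ^ (J + m) : ℕ) : ℤ)) := finite_geomTorsion_of_neZero W (2 ^ (J + m))
  have hCC' : ∀ T ∈ Cn J, W.twistedTorsionIncl 2 κ hJJ u hu T ∈ Cn (J + m) := by
    intro T hT
    rw [hCn] at hT ⊢
    have he : AddSubgroup.inclusion (geomTorsion_pow_le_geomPrimaryTorsion W 2 (J + m))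
        (W.twistedTorsionIncl 2 κ hJJ u hu T) =
      AddSubgroup.inclusion (geomTorsion_pow_le_geomPrimaryTorsion W 2 J) T := Subtype.ext rfl
    rw [he]; exact hT
  have hπ : ∀ P ∈ Cn (J + m), W.twistedTorsionMulPow 2 κ hJJ u hu P ∈ Cn J := by
    intro P hP
    rw [hCn] at hP ⊢
    have he : AddSubgroup.inclusion (geomTorsion_pow_le_geomPrimaryTorsion W 2 J)
        (W.twistedTorsionMulPow 2 κ hJJ u hu P) =
      ((2 ^ (J + m - J) : ℕ) : ℤ) • AddSubgroup.inclusion (geomTorsion_pow_le_geomPrimaryTorsion W 2 (J + m)) P :=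
      Subtype.ext (by
        rw [AddSubgroup.coe_inclusion, coe_twistedTorsionMulPow_apply, AddSubgroupClass.coe_zsmul,
          AddSubgroup.coe_inclusion])
    rw [he]; exact N.plus.zsmul_mem hP _
  have hdivm : ∀ (n : ℕ), ∀ c ∈ N.plus, ∃ c' ∈ N.plus, 2 ^ n • c' = c := by
    intro n
    induction n with
    | zero => intro c hc; exact ⟨c, hc, by rw [pow_zero, one_smul]⟩
    | succ n ih =>
      intro c hc
      obtain ⟨c₁, hc₁, h₁⟩ := ih c hc
      obtain ⟨c₂, hc₂, h₂⟩ := hdiv c₁ hc₁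
      exact ⟨c₂, hc₂, by rw [pow_succ, mul_smul, h₂, h₁]⟩
  have hπsurj : ∀ T ∈ Cn J, ∃ P ∈ Cn (J + m), W.twistedTorsionMulPow 2 κ hJJ u hu P = T := by
    intro T hT
    rw [hCn] at hT
    obtain ⟨c', hc', hc'T⟩ := hdivm m _ hT
    have hc'0 : 2 ^ (J + m) • c' = 0 := by
      rw [pow_add, mul_smul, hc'T, ← map_nsmul, htn J T, map_zero]
    refine ⟨⟨c', hlev (J + m) c' hc'0⟩, ?_, ?_⟩
    · rw [hCn]
      have he : AddSubgroup.inclusion (geomTorsion_pow_le_geomPrimaryTorsion W 2 (J + m))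
          ⟨(c' : W.geomPoints), hlev (J + m) c' hc'0⟩ = c' := Subtype.ext rfl
      rw [he]; exact hc'
    · apply Subtype.ext
      rw [coe_twistedTorsionMulPow_apply, Nat.add_sub_cancel_left]
      have h := congrArg (fun x : W.geomPrimaryTorsion 2 ↦ (x : W.geomPoints)) hc'T
      simp only [AddSubmonoidClass.coe_nsmul, AddSubgroup.coe_inclusion] at h
      rw [natCast_zsmul]
      exact h
  obtain ⟨c₀, hc₀, -, hzm⟩ := exists_generator_line W 2 (J + m) N.plus hdiv hcard (Cn (J + m)) (hCn (J + m))
  have hgen : ∀ c ∈ Cn (J + m), ∃ n : ℕ, c = n • c₀ := by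
    intro c hc
    have hfo : IsOfFinAddOrder c₀ := isOfFinAddOrder_of_finite c₀
    obtain ⟨n, hn⟩ := (AddSubmonoid.mem_multiples_iff _ _).1
      ((hfo.mem_multiples_iff_mem_zmultiples).2 (hzm c hc))
    exact ⟨n, hn.symm⟩
  have hσ₀C : ∀ a : ℕ, (∀ ζ : (AlgebraicClosure (v.adicCompletion ℚ))ˣ, ζ ^ 2 ^ (J + m) = 1 →
      Units.map (Field.absoluteGaloisGroup.toAlgEquiv (v.adicCompletion ℚ) σ₀ :
        AlgebraicClosure (v.adicCompletion ℚ) →* AlgebraicClosure (v.adicCompletion ℚ)) ζ = ζ ^ a) →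
      ∀ c ∈ Cn (J + m), absGaloisRestrict ℚ (v.adicCompletion ℚ) σ₀ • c = a • c := by
    intro a ha c hc
    have h := hInert σ₀ hσ₀I (J + m) a ha _ ((hCn _ c).1 hc) (by rw [← map_nsmul, htn (J + m) c, map_zero])
    apply Subtype.ext
    have h' := congrArg (fun x : W.geomPrimaryTorsion 2 ↦ (x : W.geomPoints)) h
    simp only [primaryComponent.coe_smul, AddSubgroup.coe_inclusion] at h'
    rw [Literature.NumberTheory.EllipticCurves.AddSubgroup.torsionBy.coe_smul, ← WeierstrassCurve.resGal_eq_absGaloisRestrict,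
      AddSubmonoidClass.coe_nsmul]
    exact h'
  have hkill : ∀ y : continuousCohomology 2 (((W.twistedTorsionGaloisModule 2 κ (J + m) u hu).restrict
      (absGaloisRestrict ℚ (v.adicCompletion ℚ))).subrepresentation (Cn (J + m)) (hCstab (J + m))).toTopRep,
      2 ^ (J + m - J) • y = 0 := by
    intro y
    rw [Nat.add_sub_cancel_left]
    exact two_pow_natAbs_smul_two_line_eq_zero W κ (J + m) u hu (Cn (J + m)) (hCstab (J + m)) c₀ hc₀ hgen σ₀ hσ₀
      hσ₀C hu1 y
  obtain ⟨t, a, hta⟩ := exists_twisted_lift W κ hJJ u hu (Cn J) (hCstab J) (Cn (J + m)) (hCstab (J + m)) hCC' hπ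
    hπsurj hkill ξ (localSubgroup κ.kerSubgroup (v.adicCompletion ℚ)) g d hξ
  /- §8 `t|_{G_K} − ι g − ∂a` is `C`-valued, hence Kummer (package (i)) -/
  have hR'G : ∀ (τ : localSubgroup κ.kerSubgroup (v.adicCompletion ℚ)) (x : W.geomTorsion ((2 ^ (J + m) : ℕ) : ℤ)),
      ((W.twistedTorsionGaloisModule 2 κ (J + m) u hu).restrict (absGaloisRestrict ℚ (v.adicCompletion ℚ)))
        (τ : absoluteGaloisGroup (v.adicCompletion ℚ)) x =
        absGaloisRestrict ℚ (v.adicCompletion ℚ) (τ : absoluteGaloisGroup (v.adicCompletion ℚ)) • x := by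
    intro τ x
    have hτ : absGaloisRestrict ℚ (v.adicCompletion ℚ) (τ : absoluteGaloisGroup (v.adicCompletion ℚ)) ∈
        κ.kerSubgroup := (mem_localSubgroup_iff κ.kerSubgroup (v.adicCompletion ℚ) _).1 τ.2
    change W.twistedTorsionGaloisModule 2 κ (J + m) u hu (absGaloisRestrict ℚ (v.adicCompletion ℚ) _) x = _
    erw [ZpExtension.galoisTwist_apply_of_mem_kerSubgroup _ _ _ _ _ _ hτ, torsionGaloisModule_apply_apply]
  have hRc : Continuous fun p : absoluteGaloisGroup (v.adicCompletion ℚ) × W.geomTorsion ((2 ^ (J + m) : ℕ) : ℤ) ↦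
      ((W.twistedTorsionGaloisModule 2 κ (J + m) u hu).restrict (absGaloisRestrict ℚ (v.adicCompletion ℚ))) p.1 p.2 :=
    ((W.twistedTorsionGaloisModule 2 κ (J + m) u hu).restrict (absGaloisRestrict ℚ (v.adicCompletion ℚ))).continuous_smul
  let inc := AddSubgroup.inclusion (geomTorsion_pow_le_geomPrimaryTorsion W 2 (J + m))
  let k₂ : localSubgroup κ.kerSubgroup (v.adicCompletion ℚ) → W.geomPrimaryTorsion 2 := fun τ ↦
    inc (t.1 τ - W.twistedTorsionIncl 2 κ hJJ u hu (g τ) -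
      (((W.twistedTorsionGaloisModule 2 κ (J + m) u hu).restrict (absGaloisRestrict ℚ (v.adicCompletion ℚ)))
        (τ : absoluteGaloisGroup (v.adicCompletion ℚ)) a - a))
  have hk₂C : ∀ τ, k₂ τ ∈ N.plus := fun τ ↦ (hCn _ _).1 (hta τ)
  have hk₂val : ∀ τ, (k₂ τ : W.geomPoints) = (t.1 τ : W.geomPoints) - (f.1 (τ' τ) : W.geomPoints) -
      (absGaloisRestrict ℚ (v.adicCompletion ℚ) (τ : absoluteGaloisGroup (v.adicCompletion ℚ)) • (a : W.geomPoints) -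
        (a : W.geomPoints)) := by
    intro τ
    change (((t.1 τ - W.twistedTorsionIncl 2 κ hJJ u hu (g τ) -
      (((W.twistedTorsionGaloisModule 2 κ (J + m) u hu).restrict (absGaloisRestrict ℚ (v.adicCompletion ℚ)))
        (τ : absoluteGaloisGroup (v.adicCompletion ℚ)) a - a)) : W.geomTorsion ((2 ^ (J + m) : ℕ) : ℤ)) :
        W.geomPoints) = _
    rw [hR'G, AddSubgroupClass.coe_sub, AddSubgroupClass.coe_sub, AddSubgroupClass.coe_sub,
      coe_twistedTorsionIncl_apply, Literature.NumberTheory.EllipticCurves.AddSubgroup.torsionBy.coe_smul]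
  have hk₂cont : Continuous k₂ := by
    refine (continuous_of_discreteTopology (f := inc)).comp ?_
    refine ((t.1.continuous.comp continuous_subtype_val).sub
      ((continuous_of_discreteTopology (f := W.twistedTorsionIncl 2 κ hJJ u hu)).comp hgcont)).sub
      ((hRc.comp (continuous_subtype_val.prodMk continuous_const)).sub continuous_const)
  have hk₂coc : ∀ τ₁ τ₂, k₂ (τ₁ * τ₂) = k₂ τ₁ +
      resGal (K := ℚ) (v.adicCompletion ℚ) (τ₁ : absoluteGaloisGroup (v.adicCompletion ℚ)) • k₂ τ₂ := by
    intro τ₁ τ₂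
    apply Subtype.ext
    rw [AddSubgroup.coe_add, primaryComponent.coe_smul, hk₂val, hk₂val, hk₂val]
    have ht12 : ((t.1 (τ₁ * τ₂) : W.geomTorsion ((2 ^ (J + m) : ℕ) : ℤ)) : W.geomPoints) =
        (t.1 τ₁ : W.geomPoints) + absGaloisRestrict ℚ (v.adicCompletion ℚ)
          (τ₁ : absoluteGaloisGroup (v.adicCompletion ℚ)) • (t.1 τ₂ : W.geomPoints) := by
      have h := t.2 (τ₁ : absoluteGaloisGroup (v.adicCompletion ℚ)) (τ₂ : absoluteGaloisGroup (v.adicCompletion ℚ))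
      change t.1 ((τ₁ : absoluteGaloisGroup (v.adicCompletion ℚ)) * τ₂) = t.1 τ₁ +
        ((W.twistedTorsionGaloisModule 2 κ (J + m) u hu).restrict (absGaloisRestrict ℚ (v.adicCompletion ℚ)))
          (τ₁ : absoluteGaloisGroup (v.adicCompletion ℚ)) (t.1 τ₂) at h
      rw [h, hR'G, AddSubgroup.coe_add,
        Literature.NumberTheory.EllipticCurves.AddSubgroup.torsionBy.coe_smul]
    have hg12 : ((f.1 (τ' (τ₁ * τ₂)) : W.geomPrimaryTorsion 2) : W.geomPoints) =
        (f.1 (τ' τ₁) : W.geomPoints) + absGaloisRestrict ℚ (v.adicCompletion ℚ)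
          (τ₁ : absoluteGaloisGroup (v.adicCompletion ℚ)) • (f.1 (τ' τ₂) : W.geomPoints) := by
      rw [hτ'mul, cocycle_mul' f, AddSubgroup.coe_add, primaryComponent.coe_smul]
      rfl
    rw [WeierstrassCurve.resGal_eq_absGaloisRestrict, Subgroup.coe_mul,
      map_mul (absGaloisRestrict ℚ (v.adicCompletion ℚ)), ht12, hg12, mul_smul]
    simp only [smul_sub]
    abel
  obtain ⟨Q₂, hQ₂⟩ := hKumC k₂ hk₂C hk₂cont hk₂coc
  /- §9 the classes agree in `H¹(G_K, E(ℚ̄_v))` -/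
  refine ⟨J + m, oneCocycleClass _ t, ?_⟩
  refine (W.twistedTorsionToLocalH1_oneCocycleClass 2 κ (J + m) u hu (v.adicCompletion ℚ) t).trans ?_
  rw [WeierstrassCurve.localResOver_kerSubgroup_oneCocycleClass, ← sub_eq_zero]
  change oneCocycleClass (discreteTopRep (localSubgroup κ.kerSubgroup (v.adicCompletion ℚ))
      (localPoints W (v.adicCompletion ℚ))) _ -
    oneCocycleClass (discreteTopRep (localSubgroup κ.kerSubgroup (v.adicCompletion ℚ))
      (localPoints W (v.adicCompletion ℚ))) _ = 0
  rw [← oneCocycleClass_sub, oneCocycleClass_eq_zero_iff]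
  refine ⟨pointsMap W (v.adicCompletion ℚ) (a : W.geomPoints) + Q₂, fun τ ↦ ?_⟩
  show pointsMap W (v.adicCompletion ℚ) ((t.1 τ : W.geomTorsion ((2 ^ (J + m) : ℕ) : ℤ)) : W.geomPoints) -
      pointsMap W (v.adicCompletion ℚ) ((f.1 (τ' τ) : W.geomPrimaryTorsion 2) : W.geomPoints) =
    (τ : absoluteGaloisGroup (v.adicCompletion ℚ)) • (pointsMap W (v.adicCompletion ℚ) (a : W.geomPoints) + Q₂) -
      (pointsMap W (v.adicCompletion ℚ) (a : W.geomPoints) + Q₂)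
  have hps : ∀ (σ : absoluteGaloisGroup (v.adicCompletion ℚ)) (P : W.geomPoints),
      pointsMap W (v.adicCompletion ℚ) (absGaloisRestrict ℚ (v.adicCompletion ℚ) σ • P) =
        σ • pointsMap W (v.adicCompletion ℚ) P := fun σ P ↦ by
    rw [← WeierstrassCurve.resGal_eq_absGaloisRestrict, pointsMap_smul]
  have h := hQ₂ τ
  rw [hk₂val, map_sub, map_sub, map_sub, hps, sub_eq_iff_eq_add] at h
  rw [h, smul_add]
  abel

end Summit.BirchSwinnertonDyer.BirchSwinnertonDyer.Theorems.MultTransportTwistedDescent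

end
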